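import Literature.MathematicalPhysics.QuantumFieldTheory.Balaban1983to89.B9Thm310GTorusRegularEntries
import Literature.MathematicalPhysics.QuantumFieldTheory.Balaban1983to89.B9Thm310CommutatorSum

/-!
# `Balaban1983to89.B9Thm310GTorusRegularCover` — T. Bałaban, *Propagators for lattice gauge theories in a background field*, Commun. Math. Phys. **99** (1985)
# 389–434 [Balaban1985BackgroundPropagators], Theorem 3.10 ⇒ Theorem 3.3 (3.42) for `G(U) = Δ_a(U)⁻¹` AT THE CUBE COVER OF RECORD: FILE 1-B ∕ 2-B's endpoints
# with the cube terms' (3.42)₁ majorants read off the cube letters' blocks over the class and the FIRST FAMILY of the remainder `R` DISCHARGED by FILE 3-B —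
# the consumer-facing form of module M5.7 for the sup-entries (sub-row G-B9-LETTERS, M5.7 FILE 6-B)

statement-level skeleton of published theorems with citation tags; proofs where landed; nothing here is a claim about the Yang–Mills mass gap

PDF held: `paper:balaban1985-cmp99-background-propagators` (journal page = PDF page + 388); pp. 397, 399, 409–410, 414–416 read from the held text layer.

THE PRINT.  p. 414 (3.105)–(3.106): *«Δ_aG₀ = I − Σ_□K(h_□)G_□h_□ − Σ_□(1 − ζ_□̃)DPD*h_□G_□h_□ − Σ_□ζ_□̃(DPD* − DP_□D*)h_□G_□h_□ − Σ_□ζ_□̃P_{□,1}(∂h_□)G_□h_□ = I − R …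
The operator K(h_□)G_□h_□ satisfies the inequality (3.89), hence it is small. Next we will analyze the other operators in R and we will prove that they are small
also. … For M sufficiently large this implies G = G₀(I − R)⁻¹»*; p. 416: *«Theorem 3.10 implies Theorem 3.3»*; p. 399, Theorem 3.3: *«the operator G(U) (a = 1)
satisfies the inequalities (3.42)–(3.47) … The constants in the inequalities depend on d and L only»*; p. 397 (3.42).

WHY THIS FILE (cell context: G-B9-LETTERS M5.7, `lit-balaban-p38/PLAN-M57-g38.md` §3).  FILE 1-B (`B9Thm310GTorusRegular`) and FILE 2-B (`…Entries`) take the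
TOTAL remainder's majorant `Θ·e^{−δ₀d}` as one displayed input `hR`; FILE 3-B (`B9Thm310CommutatorSum`) proved that its first family `Σ_□K(h_□)G_□(U)h_□` has the
majorant `Θ₁·e^{−δ₀d}`, `Θ₁ = N′·θ₀·M⁻¹` with `N′ = 3·5^{d+1}·e^{αδ₀(2L+4)}·c₁(α)` and ONE `θ₀` for the cubes of every level, from the cube letters' (3.42) blocks
over the class, bi-contractivity and one plaquette datum.  THIS FILE substitutes it: the remainder's majorant becomes `(Θ₁ + Θ′)·e^{−δ₀d}` with `Θ′` the
displayed majorant of the three other families (p. 415's walk re-expansion of `P`, (3.101): cell GAPS G-B9-05∕06a∕07), the cube terms' (3.42)₁ majorants are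
READ off the same blocks (FILE 1-B `hT_of_eBlockInvB_cube`, p21's `hcnt_SQT`: `N = 3·5^{d+1}`), and the two endpoints are restated AT THE COVER OF RECORD:
★★ `e0_kernelFamilyBInv_GAY_le_of_cover` ((3.42)₁) and ★★★ `eBlock_kernelFamilyBInv_GAY_of_cover` (all four sup-entries), constants and rate EXPLICIT, the
smallness «M sufficiently large» now reading `(Θ₁ + Θ′)·c₁(α) < 1` with `Θ₁ = O(M⁻¹)` uniformly in `k`.

WHAT IS PROVED (all `theorem`s, 0 `def`, 0 sorry).  §1 `hasMajorant_add4_of_head` (bookkeeping: a majorant of the first family and one of the other three give one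
of the four-family sum); §2 ★ `hasMajorant_conj_GAY_of_cover`, ★★ `e0_kernelFamilyBInv_GAY_le_of_cover`; §3 ★★★ `eBlock_kernelFamilyBInv_GAY_of_cover`.
HONEST SCOPE.  DISPLAYED: `hE` (Cor. 3.6 ∕ Thm 3.3 blocks of every cube letter `G_□(U)` — M5.1b ∕ M5.2-bond at r05's `GACubeY`), `hrest` (families 2–4 of `R`),
for §3 also the cube Leibniz majorants `hTE`∕`hTF`∕`hTL` with their sums and the transposed remainder's `hV` (PLAN items 4a∕4b∕4c∕5), `hinvU`, `hinvC`,
bi-contractivity `hU`∕`hT` (unitary fibre), the plaquette datum `hW` (print's class (3.35): `…DataOfPlaquettes.plaquetteDefect_of_reg335P` at `M_N(ℂ)`),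
`η = |c_f|⁻¹`, `0 ≤ b₁`, [4] Lemma 2.1 (`h261`, `h263`).  Nothing continuum ∕ OS ∕ mass gap ∕ Clay; YM mass gap NOT proved by any of this (Track A conditional
rung).  `--supports stmt-QuantumFields-19200`.  Net new unproved facts: 0.
-/

noncomputable section

namespace Literature.MathematicalPhysics.QuantumFieldTheory.Balaban1983to89.B9Thm310GTorusRegularCover

open Node00 B9CubeLettersInvReadings
open B6GlobalChartV1 (blkV1)
open B6Ineq2142KLevelV1 (β)
open B6KLevelCensusIndexV1 (KIdx)
open B6Cover236MultiLevelBlocks (cubes)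
open B6RandomWalk (HasMajorant Triangle254 Ineq261 Ineq263 hasMajorant_mono hasMajorant_add c1_nonneg)
open B9Thm34Ext (toB6)
open B9FromB6 (EBlock)
open B9GeoNormsKLevelV1 (geo9K)
open B9Eq352DivFormLetters (conj)
open B9Thm37Sum (mulOp)
open B9Thm37CubeCoverCommutators (cutMulY hTY)
open B9Eq3104CutoffCommutators (hBdY KhBY DPDsY)
open B9CubeLettersBondOpsL0 (deltaACubeY GACubeY)
open B9Eq3105AtLetters (DPDsCubeY P1CubeY)
open B9Thm310CommutatorBound389B (theta389B theta389B_nonneg)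
open B9Thm37GpTorusRegularCubes (SQT hcnt_SQT)
open B9Thm310GTorusRegular (hasMajorant_conj_GAY_of_cubeCover e0_kernelFamilyBInv_le_of_hasMajorant hT_of_eBlockInvB_cube)
open B9Thm310GTorusRegularEntries (eBlock_kernelFamilyBInv_GAY_of_cubes)
open B9Thm310CommutatorSum (hasMajorant_sum_conj_KhBY_GACubeY_hTY)
open Node00.OpsYNablaBridge (chartY)
open scoped Matrix

/-! ## §1 Bookkeeping: the four-family remainder from its first family and the rest -/

section Generic

variable {Gb : B6.Geometry} {X : Type}

/-- bookkeeping ([4] p. 232 «A summation preserves it also»): a majorant `Θ₁·E` of the first family `A` and a majorant `Θ′·E` of the sum `B + C + D` of the other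
three give the four-family sum `A + B + C + D` the majorant `(Θ₁ + Θ′)·E`. [cite: Balaban1984PropagatorsII, (2.51)–(2.52) p.232; Balaban1985BackgroundPropagators, (3.105) p.414] -/
theorem hasMajorant_add4_of_head (blk : X → Gb.Site) {A B C D : Module.End ℝ (X → ℝ)} {Θ₁ Θ' : ℝ} {E : Gb.Site → Gb.Site → ℝ}
    (h1 : HasMajorant blk A (fun a a' => Θ₁ * E a a')) (h2 : HasMajorant blk (B + C + D) (fun a a' => Θ' * E a a')) :
    HasMajorant blk (A + B + C + D) (fun a a' => (Θ₁ + Θ') * E a a') := by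
  have he : A + B + C + D = A + (B + C + D) := by abel
  rw [he]
  exact hasMajorant_mono blk (hasMajorant_add blk h1 h2) fun a a' => le_of_eq (by ring)

end Generic

variable {d ℓ : ℕ} {hd : 1 ≤ d + 1} {hL : Odd (ℓ + 1) ∧ 1 < ℓ + 1} {b₀ b₁ : ℝ}
variable {𝔸 : Type} [NormedRing 𝔸] [NormedAlgebra ℂ 𝔸] [CompleteSpace 𝔸]
variable {ι : Type} [Fintype ι] [DecidableEq ι]
variable (i : KIdx d ℓ hd hL b₀ b₁) (b : Module.Basis ι ℝ 𝔸)
variable [Fintype (geo9K i).Site] [DecidableEq (geo9K i).Site] {Rr : ℝ} {Hp : Prop}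
variable (ιB : BlkY i → IBondY i)
variable {B : B9.Backgrounds} (cfg : B.Cfg → CfgY 𝔸 i) (par : BondParY 𝔸 i) {U₁ : B.Cfg}

/-! ## §2 (3.42)₁ for `G(U)` at the cover of record, the first family of `R` discharged -/

section Entry1

/-- ★ **THE (3.42)₁ MAJORANT OF `conj b G(U)` AT THE COVER OF RECORD, FIRST FAMILY OF `R` DISCHARGED**: FILE 1-B's `hasMajorant_conj_GAY_of_cubeCover` with the
remainder's majorant `(Θ₁ + Θ′)·e^{−δ₀d}`, `Θ₁ = 3·5^{d+1}·e^{αδ₀(2L+4)}·c₁(α)·M₂(Σ‖b_j‖)·θ₃₈₉ᴮ(d,L,B₀,b₁,δ₀,1,2δ̂,δ̂(L²+1),δ̂;0)·M⁻¹` (FILE 3-B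
`hasMajorant_sum_conj_KhBY_GACubeY_hTY`) and `Θ′` the displayed majorant of families 2–4 (`hrest`); inputs: the cube letters' blocks `hE`, bi-contractivity `hU`∕`hT`,
`η = |c_f|⁻¹`, the plaquette datum `hW`, `IsUnit Δ_{a,□}(U)` ∕ `IsUnit Δ_a(U)`, `ζ_□̃ = 1` on `supp h_□`, [4] Lemma 2.1, `(Θ₁ + Θ′)·c₁(α) < 1`.
[cite: Balaban1985BackgroundPropagators, Thm 3.10 p.416 + (3.105)–(3.106) p.414 ⇒ Thm 3.3 p.399 (3.42)₁ p.397; Balaban1984PropagatorsII, Prop. 2.2 (2.64)–(2.66) p.234] -/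
theorem hasMajorant_conj_GAY_of_cover (hι : ∀ s, β i.hN i.D i.hk (ιB s) = s)
    {M₂ : ℝ} (hM₂ : 0 ≤ M₂) (hrepr : ∀ (v : 𝔸) (j : ι), |b.repr v j| ≤ M₂ * ‖v‖) (hη : etaS i = |i.cf|⁻¹) (hb₁ : 0 ≤ b₁)
    (d' : ℕ) {δ₀ α Θ' B₀ δh : ℝ}
    (parS : SiteParY 𝔸 i) (parB : BondParY 𝔸 i) (Gp : SiteOpY 𝔸 i)
    (ζ : ↥(cubes i.D.toDomains) → SiteY i → ℝ) (hζ : ∀ c z, hTY i c z ≠ 0 → ζ c z = 1)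
    (hinvC : ∀ c : ↥(cubes i.D.toDomains), IsUnit (deltaACubeY i c parS parB (cfg U₁))) (hinvU : IsUnit (deltaAY i parS parB Gp (cfg U₁)))
    (hB₀ : 0 ≤ B₀) (hδ₀ : 0 ≤ δ₀) (hΘ' : 0 ≤ Θ') (hδh : 0 ≤ δh) (hαδ : 0 ≤ α * δ₀) (hαδ1 : 0 ≤ (1 - α) * δ₀)
    (htri : Triangle254 (toB6 (geo9K i) Rr Hp)) (hrefl : ∀ y : (geo9K i).Site, (geo9K i).dist y y = 0)
    (hdnn : ∀ y y' : (geo9K i).Site, 0 ≤ (geo9K i).dist y y')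
    (h261 : Ineq261 d' (toB6 (geo9K i) Rr Hp) δ₀ α) (h263 : Ineq263 d' (toB6 (geo9K i) Rr Hp) δ₀ α)
    (hsmall : ((3 * 5 ^ (d + 1) * (Real.exp (α * δ₀ * (2 * (ℓ : ℝ) + 6)) * B6.c1 d' δ₀ α)) *
        (M₂ * (∑ j, ‖b j‖) * theta389B d ℓ B₀ b₁ δ₀ 1 (2 * δh) (δh * (((ℓ : ℝ) + 1) ^ 2 + 1)) δh 0 * ((geo9K i).M)⁻¹) + Θ') * B6.c1 d' δ₀ α < 1)
    (hE : ∀ c : ↥(cubes i.D.toDomains), EBlock (kernelFamilyBInv i B cfg (GACubeY i c parS parB) par) B₀ δ₀ U₁)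
    (hU : ∀ μ x, ‖(cfg U₁ μ x : 𝔸)‖ ≤ 1 ∧ ‖(((cfg U₁ μ x)⁻¹ : 𝔸ˣ) : 𝔸)‖ ≤ 1)
    (hT : ∀ (y : IBondY i) (f : FBondY i), ‖(qT i parB (cfg U₁) y f : 𝔸)‖ ≤ 1 ∧ ‖(((qT i parB (cfg U₁) y f)⁻¹ : 𝔸ˣ) : 𝔸)‖ ≤ 1)
    (hW : ∀ p : PlaqY i, ‖((holY i (cfg U₁) p : 𝔸ˣ) : 𝔸) - 1‖ ≤ δh * ((((ℓ : ℝ) + 1) ^ levY i (chartY i p.src))⁻¹) ^ 2)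
    (hrest : HasMajorant (g := toB6 (geo9K i) Rr Hp) (fun p : FBondY i × ι => ιB (blkV1 i.hN i.D p.1))
      (∑ c, conj b (((1 - cutMulY (hBdY i (ζ c))) * DPDsY i parS Gp (cfg U₁) *
            (cutMulY (hBdY i (hTY i c)) * GACubeY i c parS parB (cfg U₁) * cutMulY (hBdY i (hTY i c)))).restrictScalars ℝ)
        + ∑ c, conj b ((cutMulY (hBdY i (ζ c)) * (DPDsY i parS Gp (cfg U₁) - DPDsCubeY i c parS (cfg U₁)) *
            (cutMulY (hBdY i (hTY i c)) * GACubeY i c parS parB (cfg U₁) * cutMulY (hBdY i (hTY i c)))).restrictScalars ℝ)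
        + ∑ c, conj b ((cutMulY (hBdY i (ζ c)) * P1CubeY i c (hTY i c) parS (cfg U₁) * GACubeY i c parS parB (cfg U₁) *
            cutMulY (hBdY i (hTY i c))).restrictScalars ℝ))
      (fun a a' => Θ' * Real.exp (-(δ₀ * (geo9K i).dist a a')))) :
    HasMajorant (g := toB6 (geo9K i) Rr Hp) (fun p : FBondY i × ι => ιB (blkV1 i.hN i.D p.1))
      (conj b ((GAY i parS parB Gp (cfg U₁)).restrictScalars ℝ))
      (fun a a' => (3 * 5 ^ (d + 1)) * (M₂ * (∑ j, ‖b j‖) * B₀) * B6.c1 d' δ₀ α *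
          (1 - ((3 * 5 ^ (d + 1) * (Real.exp (α * δ₀ * (2 * (ℓ : ℝ) + 6)) * B6.c1 d' δ₀ α)) *
            (M₂ * (∑ j, ‖b j‖) * theta389B d ℓ B₀ b₁ δ₀ 1 (2 * δh) (δh * (((ℓ : ℝ) + 1) ^ 2 + 1)) δh 0 * ((geo9K i).M)⁻¹) + Θ') *
            B6.c1 d' δ₀ α)⁻¹ * (geo9K i).len a ^ 2 *
        Real.exp (-((1 - α) * δ₀ * (geo9K i).dist a a'))) := by
  have hSb : 0 ≤ ∑ j, ‖b j‖ := Finset.sum_nonneg fun _ _ => norm_nonneg _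
  have hΘ₁ : 0 ≤ (3 * 5 ^ (d + 1) * (Real.exp (α * δ₀ * (2 * (ℓ : ℝ) + 6)) * B6.c1 d' δ₀ α)) *
      (M₂ * (∑ j, ‖b j‖) * theta389B d ℓ B₀ b₁ δ₀ 1 (2 * δh) (δh * (((ℓ : ℝ) + 1) ^ 2 + 1)) δh 0 * ((geo9K i).M)⁻¹) :=
    mul_nonneg (mul_nonneg (by positivity) (mul_nonneg (Real.exp_nonneg _) (c1_nonneg d' δ₀ α)))
      (mul_nonneg (mul_nonneg (mul_nonneg hM₂ hSb) (theta389B_nonneg d ℓ hB₀ hb₁ zero_le_one (by positivity) (by positivity) hδh δ₀ 0))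
        (inv_nonneg.2 (B9GeoLemma21KLevelV1.geo9K_M_nonneg i)))
  exact hasMajorant_conj_GAY_of_cubeCover i b ιB cfg hι hM₂ hrepr d' parS parB Gp par ζ hζ hinvC hinvU hB₀ (add_nonneg hΘ₁ hΘ') hαδ1 htri hrefl hdnn
    h261 h263 hsmall hE
    (hasMajorant_add4_of_head _ (hasMajorant_sum_conj_KhBY_GACubeY_hTY i b ιB cfg par hι hM₂ hrepr hη parS parB hB₀ hδ₀ hE hU hT hδh hW d' hαδ h261)
      hrest)

/-- ★★ **(3.42)₁ FOR def-Y's `G(U)` AS THE `e 0` ENTRY OF `kernelFamilyBInv … (GAY i parS parB Gp) …` OVER THE CLASS AT `U₁`, AT THE COVER OF RECORD, FIRST FAMILY OF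
`R` DISCHARGED** — constant `M₂(Σ‖b_j‖)·3·5^{d+1}·M₂(Σ‖b_j‖)B₀·c₁(α)·(1 − (Θ₁ + Θ′)c₁(α))⁻¹`, rate `(1−α)δ₀` (p. 399 «The constants in the inequalities depend on d
and L only»: here on `d, L, α, δ₀, B₀, b₁, δ̂, M₂Σ‖b_j‖` and `M` through `Θ₁ = O(M⁻¹)`). [cite: Balaban1985BackgroundPropagators, Thm 3.3 p.399 (3.42)₁ p.397 via Thm 3.10 pp.414–416] -/
theorem e0_kernelFamilyBInv_GAY_le_of_cover (hι : ∀ s, β i.hN i.D i.hk (ιB s) = s)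
    {M₂ : ℝ} (hM₂ : 0 ≤ M₂) (hrepr : ∀ (v : 𝔸) (j : ι), |b.repr v j| ≤ M₂ * ‖v‖) (hη : etaS i = |i.cf|⁻¹) (hb₁ : 0 ≤ b₁)
    (d' : ℕ) {δ₀ α Θ' B₀ δh : ℝ}
    (parS : SiteParY 𝔸 i) (parB : BondParY 𝔸 i) (Gp : SiteOpY 𝔸 i)
    (ζ : ↥(cubes i.D.toDomains) → SiteY i → ℝ) (hζ : ∀ c z, hTY i c z ≠ 0 → ζ c z = 1)
    (hinvC : ∀ c : ↥(cubes i.D.toDomains), IsUnit (deltaACubeY i c parS parB (cfg U₁))) (hinvU : IsUnit (deltaAY i parS parB Gp (cfg U₁)))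
    (hB₀ : 0 ≤ B₀) (hδ₀ : 0 ≤ δ₀) (hΘ' : 0 ≤ Θ') (hδh : 0 ≤ δh) (hαδ : 0 ≤ α * δ₀) (hαδ1 : 0 ≤ (1 - α) * δ₀)
    (htri : Triangle254 (toB6 (geo9K i) Rr Hp)) (hrefl : ∀ y : (geo9K i).Site, (geo9K i).dist y y = 0)
    (hdnn : ∀ y y' : (geo9K i).Site, 0 ≤ (geo9K i).dist y y')
    (h261 : Ineq261 d' (toB6 (geo9K i) Rr Hp) δ₀ α) (h263 : Ineq263 d' (toB6 (geo9K i) Rr Hp) δ₀ α)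
    (hsmall : ((3 * 5 ^ (d + 1) * (Real.exp (α * δ₀ * (2 * (ℓ : ℝ) + 6)) * B6.c1 d' δ₀ α)) *
        (M₂ * (∑ j, ‖b j‖) * theta389B d ℓ B₀ b₁ δ₀ 1 (2 * δh) (δh * (((ℓ : ℝ) + 1) ^ 2 + 1)) δh 0 * ((geo9K i).M)⁻¹) + Θ') * B6.c1 d' δ₀ α < 1)
    (hE : ∀ c : ↥(cubes i.D.toDomains), EBlock (kernelFamilyBInv i B cfg (GACubeY i c parS parB) par) B₀ δ₀ U₁)
    (hU : ∀ μ x, ‖(cfg U₁ μ x : 𝔸)‖ ≤ 1 ∧ ‖(((cfg U₁ μ x)⁻¹ : 𝔸ˣ) : 𝔸)‖ ≤ 1)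
    (hT : ∀ (y : IBondY i) (f : FBondY i), ‖(qT i parB (cfg U₁) y f : 𝔸)‖ ≤ 1 ∧ ‖(((qT i parB (cfg U₁) y f)⁻¹ : 𝔸ˣ) : 𝔸)‖ ≤ 1)
    (hW : ∀ p : PlaqY i, ‖((holY i (cfg U₁) p : 𝔸ˣ) : 𝔸) - 1‖ ≤ δh * ((((ℓ : ℝ) + 1) ^ levY i (chartY i p.src))⁻¹) ^ 2)
    (hrest : HasMajorant (g := toB6 (geo9K i) Rr Hp) (fun p : FBondY i × ι => ιB (blkV1 i.hN i.D p.1))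
      (∑ c, conj b (((1 - cutMulY (hBdY i (ζ c))) * DPDsY i parS Gp (cfg U₁) *
            (cutMulY (hBdY i (hTY i c)) * GACubeY i c parS parB (cfg U₁) * cutMulY (hBdY i (hTY i c)))).restrictScalars ℝ)
        + ∑ c, conj b ((cutMulY (hBdY i (ζ c)) * (DPDsY i parS Gp (cfg U₁) - DPDsCubeY i c parS (cfg U₁)) *
            (cutMulY (hBdY i (hTY i c)) * GACubeY i c parS parB (cfg U₁) * cutMulY (hBdY i (hTY i c)))).restrictScalars ℝ)
        + ∑ c, conj b ((cutMulY (hBdY i (ζ c)) * P1CubeY i c (hTY i c) parS (cfg U₁) * GACubeY i c parS parB (cfg U₁) *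
            cutMulY (hBdY i (hTY i c))).restrictScalars ℝ))
      (fun a a' => Θ' * Real.exp (-(δ₀ * (geo9K i).dist a a'))))
    (lam : (geo9K i).Loc) (y y' : IBondY i) (hs : (geo9K i).suppIn lam y') :
    (kernelFamilyBInv i B cfg (GAY i parS parB Gp) par).e 0 U₁ lam y ≤
      M₂ * (∑ j, ‖b j‖) * ((3 * 5 ^ (d + 1)) * (M₂ * (∑ j, ‖b j‖) * B₀) * B6.c1 d' δ₀ α *
          (1 - ((3 * 5 ^ (d + 1) * (Real.exp (α * δ₀ * (2 * (ℓ : ℝ) + 6)) * B6.c1 d' δ₀ α)) *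
            (M₂ * (∑ j, ‖b j‖) * theta389B d ℓ B₀ b₁ δ₀ 1 (2 * δh) (δh * (((ℓ : ℝ) + 1) ^ 2 + 1)) δh 0 * ((geo9K i).M)⁻¹) + Θ') *
            B6.c1 d' δ₀ α)⁻¹) *
        (geo9K i).len y ^ 2 * Real.exp (-((1 - α) * δ₀ * (geo9K i).dist y y')) * (geo9K i).supNorm lam := by
  have hSb : 0 ≤ ∑ j, ‖b j‖ := Finset.sum_nonneg fun _ _ => norm_nonneg _
  have hC : 0 ≤ (3 * 5 ^ (d + 1)) * (M₂ * (∑ j, ‖b j‖) * B₀) * B6.c1 d' δ₀ α *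
      (1 - ((3 * 5 ^ (d + 1) * (Real.exp (α * δ₀ * (2 * (ℓ : ℝ) + 6)) * B6.c1 d' δ₀ α)) *
        (M₂ * (∑ j, ‖b j‖) * theta389B d ℓ B₀ b₁ δ₀ 1 (2 * δh) (δh * (((ℓ : ℝ) + 1) ^ 2 + 1)) δh 0 * ((geo9K i).M)⁻¹) + Θ') *
        B6.c1 d' δ₀ α)⁻¹ :=
    mul_nonneg (mul_nonneg (mul_nonneg (by positivity) (mul_nonneg (mul_nonneg hM₂ hSb) hB₀)) (c1_nonneg d' δ₀ α))
      (inv_nonneg.2 (sub_nonneg.2 hsmall.le))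
  exact e0_kernelFamilyBInv_le_of_hasMajorant i b ιB cfg hι hM₂ hrepr (GAY i parS parB Gp) par ((GAY i parS parB Gp (cfg U₁)).restrictScalars ℝ)
    (fun _ => rfl) hC
    (hasMajorant_conj_GAY_of_cover i b ιB cfg par hι hM₂ hrepr hη hb₁ d' parS parB Gp ζ hζ hinvC hinvU hB₀ hδ₀ hΘ' hδh hαδ hαδ1 htri hrefl hdnn h261 h263
      hsmall hE hU hT hW hrest)
    lam y y' hs

end Entry1

/-! ## §3 All four sup-entries (3.42) for `G(U)` at the cover of record, the first family of `R` discharged -/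

section Block

/-- ★★★ **THEOREM 3.10 ⇒ THE (3.42) BLOCK OF `kernelFamilyBInv … (GAY i parS parB Gp) …` OVER THE CLASS AT `U₁`, AT THE COVER OF RECORD, FIRST FAMILY OF `R`
DISCHARGED**: FILE 2-B's `eBlock_kernelFamilyBInv_GAY_of_cubes` with `S_□ = SQT □`, `N = 3·5^{d+1}`, the cube terms' (3.42)₁ majorants READ off the cube letters'
blocks `hE` (`B₀ ↦ M₂(Σ‖b_j‖)B₀`), and the remainder's majorant `(Θ₁ + Θ′)·e^{−δ₀d}` (FILE 3-B + `hrest`).  Still displayed: the cube Leibniz majorants `hTE`∕`hTF`∕`hTL`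
with their sums (entries 2–4 of Thm 3.3 for `G_□(U)` through (3.100)–(3.104)), the transposed remainder's `hV`, `hinvU`, `hinvC`, bi-contractivity, the plaquette
datum, [4] Lemma 2.1 and the two smallness conditions.  Output: `EBlock (kernelFamilyBInv i B cfg (GAY i parS parB Gp) par) (M₂(Σ‖b_j‖)·Bc) ((1−2α)δ₀) U₁`,
`Bc = (3·5^{d+1}·M₂(Σ‖b_j‖)B₀ + A₁ + A₃)·c₁(α)(1 − (Θ₁+Θ′)c₁(α))⁻¹ + A₂·c₁(α)(1 − θ_Vc₁(α))⁻¹` term by term.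
[cite: Balaban1985BackgroundPropagators, Thm 3.3 p.399 (3.42) p.397 via Thm 3.10 pp.414–416; Balaban1984PropagatorsII, Prop. 2.2 (2.67) p.234] -/
theorem eBlock_kernelFamilyBInv_GAY_of_cover (hι : ∀ s, β i.hN i.D i.hk (ιB s) = s)
    {M₂ : ℝ} (hM₂ : 0 ≤ M₂) (hrepr : ∀ (v : 𝔸) (j : ι), |b.repr v j| ≤ M₂ * ‖v‖) (hη : etaS i = |i.cf|⁻¹) (hb₁ : 0 ≤ b₁)
    (parS : SiteParY 𝔸 i) (parB : BondParY 𝔸 i) (Gp : SiteOpY 𝔸 i)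
    (ζ : ↥(cubes i.D.toDomains) → SiteY i → ℝ) (hζ : ∀ c z, hTY i c z ≠ 0 → ζ c z = 1)
    (hinvC : ∀ c : ↥(cubes i.D.toDomains), IsUnit (deltaACubeY i c parS parB (cfg U₁))) (hinvU : IsUnit (deltaAY i parS parB Gp (cfg U₁)))
    (D Ds : Fin (d + 1) → Module.End ℝ (FBondY i → 𝔸)) (hD : ∀ ν Λ, D ν Λ = cdB i (cfg U₁) ν Λ) (hDs : ∀ ν Λ, Ds ν Λ = cdsB i (cfg U₁) ν Λ)
    (Lp : Module.End ℝ (FBondY i → 𝔸)) (hLp : ∀ Λ, Lp Λ = lapB i (cfg U₁) Λ)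
    (d' : ℕ) {δ₀ α Θ' θV B₀ δh A₁ A₂ A₃ : ℝ}
    (KE KF : Fin (d + 1) → ↥(cubes i.D.toDomains) → (geo9K i).Site → (geo9K i).Site → ℝ)
    (KL : ↥(cubes i.D.toDomains) → (geo9K i).Site → (geo9K i).Site → ℝ)
    (hB₀ : 0 ≤ B₀) (hδ₀ : 0 ≤ δ₀) (hΘ' : 0 ≤ Θ') (hθV : 0 ≤ θV) (hδh : 0 ≤ δh) (hA₁ : 0 ≤ A₁) (hA₂ : 0 ≤ A₂) (hA₃ : 0 ≤ A₃)
    (hαδ : 0 ≤ α * δ₀) (hαδ2 : 0 ≤ (1 - 2 * α) * δ₀)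
    (h261 : Ineq261 d' (toB6 (geo9K i) Rr Hp) δ₀ α) (h263 : Ineq263 d' (toB6 (geo9K i) Rr Hp) δ₀ α)
    (hsmall : ((3 * 5 ^ (d + 1) * (Real.exp (α * δ₀ * (2 * (ℓ : ℝ) + 6)) * B6.c1 d' δ₀ α)) *
        (M₂ * (∑ j, ‖b j‖) * theta389B d ℓ B₀ b₁ δ₀ 1 (2 * δh) (δh * (((ℓ : ℝ) + 1) ^ 2 + 1)) δh 0 * ((geo9K i).M)⁻¹) + Θ') * B6.c1 d' δ₀ α < 1)
    (hsmallV : θV * B6.c1 d' δ₀ α < 1)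
    (hE : ∀ c : ↥(cubes i.D.toDomains), EBlock (kernelFamilyBInv i B cfg (GACubeY i c parS parB) par) B₀ δ₀ U₁)
    (hU : ∀ μ x, ‖(cfg U₁ μ x : 𝔸)‖ ≤ 1 ∧ ‖(((cfg U₁ μ x)⁻¹ : 𝔸ˣ) : 𝔸)‖ ≤ 1)
    (hT : ∀ (y : IBondY i) (f : FBondY i), ‖(qT i parB (cfg U₁) y f : 𝔸)‖ ≤ 1 ∧ ‖(((qT i parB (cfg U₁) y f)⁻¹ : 𝔸ˣ) : 𝔸)‖ ≤ 1)
    (hW : ∀ p : PlaqY i, ‖((holY i (cfg U₁) p : 𝔸ˣ) : 𝔸) - 1‖ ≤ δh * ((((ℓ : ℝ) + 1) ^ levY i (chartY i p.src))⁻¹) ^ 2)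
    (hrest : HasMajorant (g := toB6 (geo9K i) Rr Hp) (fun p : FBondY i × ι => ιB (blkV1 i.hN i.D p.1))
      (∑ c, conj b (((1 - cutMulY (hBdY i (ζ c))) * DPDsY i parS Gp (cfg U₁) *
            (cutMulY (hBdY i (hTY i c)) * GACubeY i c parS parB (cfg U₁) * cutMulY (hBdY i (hTY i c)))).restrictScalars ℝ)
        + ∑ c, conj b ((cutMulY (hBdY i (ζ c)) * (DPDsY i parS Gp (cfg U₁) - DPDsCubeY i c parS (cfg U₁)) *
            (cutMulY (hBdY i (hTY i c)) * GACubeY i c parS parB (cfg U₁) * cutMulY (hBdY i (hTY i c)))).restrictScalars ℝ)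
        + ∑ c, conj b ((cutMulY (hBdY i (ζ c)) * P1CubeY i c (hTY i c) parS (cfg U₁) * GACubeY i c parS parB (cfg U₁) *
            cutMulY (hBdY i (hTY i c))).restrictScalars ℝ))
      (fun a a' => Θ' * Real.exp (-(δ₀ * (geo9K i).dist a a'))))
    (hTE : ∀ ν c, HasMajorant (g := toB6 (geo9K i) Rr Hp) (fun p : FBondY i × ι => ιB (blkV1 i.hN i.D p.1))
      (conj b (D ν) * (mulOp (fun p : FBondY i × ι => hBdY i (hTY i c) p.1) * conj b ((GACubeY i c parS parB (cfg U₁)).restrictScalars ℝ) *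
        mulOp (fun p : FBondY i × ι => hBdY i (hTY i c) p.1))) (KE ν c))
    (hKE : ∀ ν a a', (∑ c, KE ν c a a') ≤ A₁ * (geo9K i).len a * Real.exp (-(δ₀ * (geo9K i).dist a a')))
    (hTL : ∀ c, HasMajorant (g := toB6 (geo9K i) Rr Hp) (fun p : FBondY i × ι => ιB (blkV1 i.hN i.D p.1))
      (conj b Lp * (mulOp (fun p : FBondY i × ι => hBdY i (hTY i c) p.1) * conj b ((GACubeY i c parS parB (cfg U₁)).restrictScalars ℝ) *
        mulOp (fun p : FBondY i × ι => hBdY i (hTY i c) p.1))) (KL c))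
    (hKL : ∀ a a', (∑ c, KL c a a') ≤ A₃ * 1 * Real.exp (-(δ₀ * (geo9K i).dist a a')))
    (hTF : ∀ ν c, HasMajorant (g := toB6 (geo9K i) Rr Hp) (fun p : FBondY i × ι => ιB (blkV1 i.hN i.D p.1))
      ((mulOp (fun p : FBondY i × ι => hBdY i (hTY i c) p.1) * conj b ((GACubeY i c parS parB (cfg U₁)).restrictScalars ℝ) *
        mulOp (fun p : FBondY i × ι => hBdY i (hTY i c) p.1)) * conj b (Ds ν)) (KF ν c))
    (hKF : ∀ ν a a', (∑ c, KF ν c a a') ≤ A₂ * (geo9K i).len a * Real.exp (-(δ₀ * (geo9K i).dist a a')))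
    (hV : HasMajorant (g := toB6 (geo9K i) Rr Hp) (fun p : FBondY i × ι => ιB (blkV1 i.hN i.D p.1))
      (-(∑ c, conj b ((cutMulY (hBdY i (hTY i c)) * GACubeY i c parS parB (cfg U₁) * KhBY i (hTY i c) parB (cfg U₁)).restrictScalars ℝ))
        - ∑ c, conj b ((cutMulY (hBdY i (hTY i c)) * GACubeY i c parS parB (cfg U₁) * P1CubeY i c (hTY i c) parS (cfg U₁)).restrictScalars ℝ)
        + ∑ c, conj b ((cutMulY (hBdY i (hTY i c)) * GACubeY i c parS parB (cfg U₁) * cutMulY (hBdY i (hTY i c)) *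
            (cutMulY (hBdY i (ζ c)) * (DPDsY i parS Gp (cfg U₁) - DPDsCubeY i c parS (cfg U₁)))).restrictScalars ℝ)
        + ∑ c, conj b ((cutMulY (hBdY i (hTY i c)) * GACubeY i c parS parB (cfg U₁) * cutMulY (hBdY i (hTY i c)) *
            ((1 - cutMulY (hBdY i (ζ c))) * DPDsY i parS Gp (cfg U₁))).restrictScalars ℝ))
      (fun a a' => θV * (geo9K i).len a * ((geo9K i).len a')⁻¹ * Real.exp (-(δ₀ * (geo9K i).dist a a')))) :
    EBlock (kernelFamilyBInv i B cfg (GAY i parS parB Gp) par)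
      (M₂ * (∑ j, ‖b j‖) *
        ((3 * 5 ^ (d + 1)) * (M₂ * (∑ j, ‖b j‖) * B₀) * B6.c1 d' δ₀ α *
            (1 - ((3 * 5 ^ (d + 1) * (Real.exp (α * δ₀ * (2 * (ℓ : ℝ) + 6)) * B6.c1 d' δ₀ α)) *
              (M₂ * (∑ j, ‖b j‖) * theta389B d ℓ B₀ b₁ δ₀ 1 (2 * δh) (δh * (((ℓ : ℝ) + 1) ^ 2 + 1)) δh 0 * ((geo9K i).M)⁻¹) + Θ') *
              B6.c1 d' δ₀ α)⁻¹ +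
          A₁ * B6.c1 d' δ₀ α *
            (1 - ((3 * 5 ^ (d + 1) * (Real.exp (α * δ₀ * (2 * (ℓ : ℝ) + 6)) * B6.c1 d' δ₀ α)) *
              (M₂ * (∑ j, ‖b j‖) * theta389B d ℓ B₀ b₁ δ₀ 1 (2 * δh) (δh * (((ℓ : ℝ) + 1) ^ 2 + 1)) δh 0 * ((geo9K i).M)⁻¹) + Θ') *
              B6.c1 d' δ₀ α)⁻¹ +
          A₂ * B6.c1 d' δ₀ α * (1 - θV * B6.c1 d' δ₀ α)⁻¹ +
          A₃ * B6.c1 d' δ₀ α *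
            (1 - ((3 * 5 ^ (d + 1) * (Real.exp (α * δ₀ * (2 * (ℓ : ℝ) + 6)) * B6.c1 d' δ₀ α)) *
              (M₂ * (∑ j, ‖b j‖) * theta389B d ℓ B₀ b₁ δ₀ 1 (2 * δh) (δh * (((ℓ : ℝ) + 1) ^ 2 + 1)) δh 0 * ((geo9K i).M)⁻¹) + Θ') *
              B6.c1 d' δ₀ α)⁻¹))
      ((1 - 2 * α) * δ₀) U₁ := by
  have hSb : 0 ≤ ∑ j, ‖b j‖ := Finset.sum_nonneg fun _ _ => norm_nonneg _
  have hΘ₁ : 0 ≤ (3 * 5 ^ (d + 1) * (Real.exp (α * δ₀ * (2 * (ℓ : ℝ) + 6)) * B6.c1 d' δ₀ α)) *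
      (M₂ * (∑ j, ‖b j‖) * theta389B d ℓ B₀ b₁ δ₀ 1 (2 * δh) (δh * (((ℓ : ℝ) + 1) ^ 2 + 1)) δh 0 * ((geo9K i).M)⁻¹) :=
    mul_nonneg (mul_nonneg (by positivity) (mul_nonneg (Real.exp_nonneg _) (c1_nonneg d' δ₀ α)))
      (mul_nonneg (mul_nonneg (mul_nonneg hM₂ hSb) (theta389B_nonneg d ℓ hB₀ hb₁ zero_le_one (by positivity) (by positivity) hδh δ₀ 0))
        (inv_nonneg.2 (B9GeoLemma21KLevelV1.geo9K_M_nonneg i)))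
  exact eBlock_kernelFamilyBInv_GAY_of_cubes i b ιB cfg par hι hM₂ hrepr parS parB Gp ζ hζ hinvC hinvU D Ds hD hDs Lp hLp d' (SQT i) KE KF KL
    (mul_nonneg (mul_nonneg hM₂ hSb) hB₀) (add_nonneg hΘ₁ hΘ') hθV (by positivity) hA₁ hA₂ hA₃ hαδ hαδ2 h261 h263 hsmall hsmallV
    (fun c => hT_of_eBlockInvB_cube i b ιB cfg hι hM₂ hrepr (GACubeY i c parS parB) par hB₀ (hE c) c) (hcnt_SQT i)
    (hasMajorant_add4_of_head _ (hasMajorant_sum_conj_KhBY_GACubeY_hTY i b ιB cfg par hι hM₂ hrepr hη parS parB hB₀ hδ₀ hE hU hT hδh hW d' hαδ h261)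
      hrest)
    hTE hKE hTL hKL hTF hKF hV

end Block

end Literature.MathematicalPhysics.QuantumFieldTheory.Balaban1983to89.B9Thm310GTorusRegularCover

end
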